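import Mathlib
import Summits.Ventures.PercRepro2.CutVertexDegenerate
import Summits.Ventures.PercRepro2.HCovSwap

/-!
# The cut vertex separating the roots, XIV: corollaries of the unconditional theorem (blind cell
PercRepro2, p3 g3, 2026-08-25; `proofs/subclaims/S2-SEPARATED.md` §4e)

`Gc_nonneg_of_cutVertex'` (CutVertexDegenerate.lean) is (HCOV) on every weighted instance in which an
unmarked vertex `c` separates `{a₁, o, b}` from `{a₂, a₃}`.  Here: the same statement as the Prop `HCov`,
the MIRROR class (`c` separates `{a₂, o, b}` from `{a₁, a₃}`) by the root symmetry `Gc_swap`, and the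
crux of record (ZΔ) on both classes under the labelling order `P(a₁ ↔ b) ≤ P(a₂ ↔ b)` (`ZDelta_of_HCov`).
Own work; standard axioms.
-/

namespace Summit.Ventures.PercRepro2

open UnionCluster

namespace CovForm

namespace RootBridge

section Corollaries

open Classical

variable {V : Type*} {E : Type*} [Fintype E] [DecidableEq E] [Fintype V] [DecidableEq V] {R : Type*}
  [Field R] [LinearOrder R] [IsStrictOrderedRing R]
variable (p : E → R) (ends : E → Sym2 V) (o a₁ a₂ a₃ b c : V)

/-- **(HCOV) on the cut-vertex class** (`c` separates `{a₁, o, b}` from `{a₂, a₃}`), as the Prop. -/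
theorem HCov_of_cutVertex (hp : IsProbVec p) {VL VH : Set V}
    (h : CutVertex ends o a₁ a₂ a₃ b c VL VH) : HCov p ends o a₁ a₂ a₃ b :=
  Gc_nonneg_of_cutVertex' p ends o a₁ a₂ a₃ b c hp h

/-- **The mirror class**: `c` separates `{a₂, o, b}` from `{a₁, a₃}` — by the root symmetry of `Gc`. -/
theorem Gc_nonneg_of_cutVertex_mirror (hp : IsProbVec p) {VL VH : Set V}
    (h : CutVertex ends o a₂ a₁ a₃ b c VL VH) : 0 ≤ Gc p ends o a₁ a₂ a₃ b := by
  rw [← Gc_swap p ends o a₁ a₂ a₃ b]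
  exact Gc_nonneg_of_cutVertex' p ends o a₂ a₁ a₃ b c hp h

/-- **(HCOV) on the mirror class**, as the Prop. -/
theorem HCov_of_cutVertex_mirror (hp : IsProbVec p) {VL VH : Set V}
    (h : CutVertex ends o a₂ a₁ a₃ b c VL VH) : HCov p ends o a₁ a₂ a₃ b :=
  Gc_nonneg_of_cutVertex_mirror p ends o a₁ a₂ a₃ b c hp h

/-- **The crux of record (ZΔ) on the cut-vertex class** under the labelling order. -/
theorem ZDelta_of_cutVertex (hp : IsProbVec p) {VL VH : Set V}
    (h : CutVertex ends o a₁ a₂ a₃ b c VL VH)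
    (hord : prob p (connEvent ends a₁ b) ≤ prob p (connEvent ends a₂ b)) :
    ZDelta p ends o a₁ a₂ a₃ b :=
  ZDelta_of_HCov p hp ends hord (Gc_nonneg_of_cutVertex' p ends o a₁ a₂ a₃ b c hp h)

/-- **(ZΔ) on the mirror class** under the labelling order. -/
theorem ZDelta_of_cutVertex_mirror (hp : IsProbVec p) {VL VH : Set V}
    (h : CutVertex ends o a₂ a₁ a₃ b c VL VH)
    (hord : prob p (connEvent ends a₁ b) ≤ prob p (connEvent ends a₂ b)) :
    ZDelta p ends o a₁ a₂ a₃ b :=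
  ZDelta_of_HCov p hp ends hord (Gc_nonneg_of_cutVertex_mirror p ends o a₁ a₂ a₃ b c hp h)

end Corollaries

end RootBridge

end CovForm

end Summit.Ventures.PercRepro2
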